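import Summits.BirchSwinnertonDyer.BirchSwinnertonDyer.Theorems.PrintX9JetchevX9CoreVertexWalkRow
import Summits.BirchSwinnertonDyer.BirchSwinnertonDyer.Theorems.PrintX9JetchevSplitStringent
import Summits.BirchSwinnertonDyer.BirchSwinnertonDyer.Theorems.Rank1ResidualJetCoreVertexExistenceOfNamedPrint
import Summits.BirchSwinnertonDyer.BirchSwinnertonDyer.Theorems.ErratumRoadFiveNonSurjCornerKolyJWalkOrders
import Summits.BirchSwinnertonDyer.BirchSwinnertonDyer.Theorems.ErratumRoadFiveNonSurjCornerKolyJProp44OfFrobeniusCongruence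
import Summits.BirchSwinnertonDyer.BirchSwinnertonDyer.Theorems.KatoDescentTamePotSupersingularJetchevIrreducibleCoreVertexRootClass
import Summits.BirchSwinnertonDyer.BirchSwinnertonDyer.Theorems.KatoDescentPotSupersingularWildJetchevBoundAtPHeegnerE0ImageFree
import HarnessLib

/-!
# Route `PrintX9`, crux J = `HeegnerDivisibilityX9` (item 20392), stub `stub_jetchevX9`: the X9 READING
# `CoreVertexExistenceX9` (Jetchev 2008 Prop. 5.3 = arXiv Prop. 6.4 «core vertices exist», at every level `m > m(c)`) IS A
# KERNEL THEOREM on the X9 Heegner frames (`ClassX9 W p`, `K` Heegner for `N_E` with `p` SPLIT, `d_K ∉ {−3,−4}`) MODULO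
# THREE NAMED LITERATURE FACTS {Gross 1991 Prop. 3.7 (2), Poitou–Tate for Selmer structures, [GZ86 III (3.1)] image-free}

Cell `bsd-print-x9` (print tier, key `x9`), prover seat p4; `--supports stmt-BirchSwinnertonDyer-20392`,
helper; THEOREMS ONLY, nothing booked, no item closed, BSD is not proved by any of this.

WHAT. The X9 twin of bsd-jet pv-1 g8's K5 strike `JET.jetchevCoreVertexExistence_lt_of_namedPrint`
(`Rank1ResidualJetCoreVertexExistenceOfNamedPrint.lean`: Prop. 5.3 at every level `m > m(c)` from named print
{[McC] Prop. 4.4, Poitou–Tate, [GZ86 III (3.1)]} for the SURJECTIVE rows, through the kernel walk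
`JET.exists_coreVertex_of_orderedFamilies`). Statement: that conclusion with the frame binders `¬CM, p ≠ 2, p-adic tower onto`
replaced by `ClassX9 W p, SatisfiesHeegnerHypothesis p K` — VERBATIM the reading binder `hCVX9` of the X9 bridge
`JET.Split.jetchevX9_of_readings_of_namedFacts` (`PrintX9JetchevX9Bridge`); hypotheses: `h37`
(`GrossLMS1991.prop37_2_frobeniusCongruence`, in place of `h44`), `hPT`, `hF1`
(`Gross1991_heegnerPoint_sub_ratTorsion_mem_E0_imageFree`, feeding the receptacle schema in frame through
`HeegnerE0ImageFree.hGZ_of_Gross1991_imageFree`). PROOF = pv-1's, byte-for-byte except at the image-dependent calls: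
the walk is `JET.Split.exists_coreVertex_of_orderedFamilies_of_classX9` (X9 Lemma 6.1 with shift, UNCONDITIONAL); the based
data family with Prop. 4.7 is cell bsd-stepL corner-p1's `Prop44.exists_data_h47Base_of_frobeniusCongruence_of_irr h37`
(irreducible, `p` split, `p ≠ 3`); `hordκ` and the class `κ̃` of a root are corner-p1's
`Koly.hordκ_of_admissibleData_of_irreducible` / `Koly.exists_tildeClass_of_exactDepth_of_irreducible` (irreducible, `p`
split); the root-class supplies are bsd-potss k9-c4's image-agnostic `JetchevIrreducibleCoreVertex.*_of_admissible` with the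
admissibility of `E(K[s]) ⊆ E(K̄)` mod `p^{k+u}` from `JET.Split.isAdmissible_of_irreducible_of_split`; the Kummer membership
one level up is `JET.Split.localization_kolyvaginClass_mem_kummerSelmerStructure_of_GZ31_of_irreducible_of_split_kolyvagin`;
no `p`-torsion over `K[c']` from x11b3's `NoTorsionIrr`. CONDITIONAL on the three named facts; nothing asserted about any curve.
References (locators only): [cite: Jetchev2008, Prop. 5.3 (p. 823) and its proof (pp. 823–824) = arXiv Prop. 6.4; §3.1, §4.2,
Prop. 4.7, Lemma 5.1, §5.2, Rem. 6.2] [cite: McCallumLMS1991, §3 Cor. 3.2, §4 Prop. 4.4] [cite: GrossLMS1991, §3 (3.1), Prop. 3.7 (2),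
Prop. 5.3, Prop. 5.4, Prop. 6.2 (1)] [cite: GrossZagier1986, III (3.1)] [cite: Howard2004HeegnerKolyvagin, Lemma 2.7.3]
[cite: MilneADT2006, Ch. I, Thm. 4.10(b)] [cite: WZhang2014, Notations (xii)].
-/

set_option autoImplicit false

noncomputable section

open scoped Classical NumberField Pointwise

namespace Summit.BirchSwinnertonDyer.Rank1Residual.JET.Split

open WeierstrassCurve IsDedekindDomain NumberField Field Literature.NumberTheory.EllipticCurves
  Literature.NumberTheory.EllipticCurves.ModularForms Literature.NumberTheory.EllipticCurves.Jetchev2008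
  Literature.NumberTheory.EllipticCurves.KolyvaginCocycle
  Literature.NumberTheory.GaloisRepresentations Literature.NumberTheory.GaloisCohomology
  Literature.NumberTheory.GaloisRepresentations.DiscreteGaloisModule
  Summit.BirchSwinnertonDyer.Rank1Residual.X11b Summit.BirchSwinnertonDyer.Rank1Residual.X11b.Three
  Summit.BirchSwinnertonDyer.Rank1Residual.X11b.Three.Koly
  Summit.BirchSwinnertonDyer.Rank1Residual.JET.SelmerVocabulary Literature.NumberTheory.Automorphic
  Summit.BirchSwinnertonDyer.BirchSwinnertonDyer.Theorems Literature.NumberTheory.EllipticCurves.Rank1Residual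

set_option maxHeartbeats 800000 in
/-- **`CoreVertexExistenceX9` (Jetchev Prop. 5.3 at every level `m > m(c)` on the X9 Heegner frames) from THREE NAMED
LITERATURE FACTS** — for `c ∈ Λ` with a datum of exact depth `s = m(c)`, `s < m`, `s + m ≤ M(c)`, there is a core vertex
`c' ∈ Λ_{m+s}` for `m` (`IsGlobalCoreVertex`) with a datum of conductor `c'` whose derived point is of infinite order and not
`p^{s+1}`-divisible. X9 twin of `JET.jetchevCoreVertexExistence_lt_of_namedPrint`; conclusion VERBATIM the binder `hCVX9` of
`JET.Split.jetchevX9_of_readings_of_namedFacts`. PROOF: the kernel walk, see the module docstring.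
[cite: Jetchev2008, Prop. 5.3 (p. 823), proof pp. 823–824] [cite: McCallumLMS1991, §3 Cor. 3.2, §4 Prop. 4.4]
[cite: GrossLMS1991, Prop. 3.7 (2), Prop. 5.4, Prop. 6.2 (1)] [cite: GrossZagier1986, III (3.1)] -/
theorem coreVertexExistenceX9_of_namedFacts
    (h37 : GrossLMS1991.prop37_2_frobeniusCongruence)
    (hPT : ∀ (K : Type) [Field K] [NumberField K], poitouTate_selmerStructure_duality_conj K)
    (hF1 : Gross1991_heegnerPoint_sub_ratTorsion_mem_E0_imageFree) :
    ∀ (W : WeierstrassCurve ℚ) [W.IsElliptic] [W.IsGloballyMinimal] [NeZero (W.conductorNorm ℤ)],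
      ∀ (K : Type) [Field K] [NumberField K], IsImaginaryQuadratic K →
      NumberField.discr K ≠ -3 → NumberField.discr K ≠ -4 →
      SatisfiesHeegnerHypothesis (W.conductorNorm ℤ) K →
      ∀ (τ : K ≃ₐ[ℚ] K), τ ≠ 1 →
      ∀ (p : ℕ) [Fact p.Prime], ClassX9 W p → SatisfiesHeegnerHypothesis p K →
      ∀ (Dt : ModularParametrizationData W (W.conductorNorm ℤ)) (β : ℤ) (ι : K →+* ℂ)
        [∀ k : ℕ, NumberField (ringClassField K ι k)]
        (d₁ : KolyvaginHeegnerData Dt β ι 1), ¬ IsOfFinAddOrder d₁.derivedPoint →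
      ∀ (m : ℕ), 1 ≤ m →
      ∀ (c : ℕ) (d : KolyvaginHeegnerData Dt β ι c), Squarefree c →
        (∀ ℓ ∈ c.primeFactors, Zhang2014.IsKolyvaginPrime (W.conductorNorm ℤ) W K p ℓ) →
      ∀ (s : ℕ), s < m → ¬ IsOfFinAddOrder d.derivedPoint →
        (∃ Q : (W.baseChange (ringClassField K ι c)).toAffine.Point,
          ((p ^ s : ℕ) : ℤ) • Q = d.derivedPoint) →
        (¬ ∃ Q : (W.baseChange (ringClassField K ι c)).toAffine.Point,
          ((p ^ (s + 1) : ℕ) : ℤ) • Q = d.derivedPoint) →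
        ((s + m : ℕ) : ℕ∞) ≤ Zhang2014.levelIndex W p c →
        ∃ (c' : ℕ) (d' : KolyvaginHeegnerData Dt β ι c'), Squarefree c' ∧
          (∀ ℓ ∈ c'.primeFactors, Zhang2014.IsKolyvaginPrime (W.conductorNorm ℤ) W K p ℓ ∧
            m + s ≤ Zhang2014.kolyvaginIndex W p ℓ) ∧
          IsGlobalCoreVertex W K ι τ p m c' ∧
          ¬ IsOfFinAddOrder d'.derivedPoint ∧
          ¬ ∃ Q : (W.baseChange (ringClassField K ι c')).toAffine.Point,
            ((p ^ (s + 1) : ℕ) : ℤ) • Q = d'.derivedPoint := by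
  intro W _ _ _ K _ _ hK hD3 hD4 hH τ hτ p _ hX9 hHp Dt β ι _ _d₁ _hy k hk c d hcsq hcKol s hsk
    _hnt hdvd hndvd hsM
  have hp : p.Prime := Fact.out
  have hp2 : p ≠ 2 := hX9.ne_two
  have hp3 : p ≠ 3 := hX9.ne_three
  have hirr : W.HasIrreducibleModPGaloisRep p := hX9.irr
  have hCM1 := phi_heegnerPointOfConductor_mem_range_map_ringClassField_holds (W.conductorNorm ℤ) W K
  have hCM2 : exists_generator_ringClassGalOver K := exists_generator_ringClassGalOver_holds
  have hD : NumberField.discr K < -4 := KolyvaginAssembly.discr_lt_neg_four hK ⟨hD3, hD4⟩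
  have hND : IsCoprime ((W.conductorNorm ℤ : ℕ) : ℤ) (NumberField.discr K) :=
    KolyvaginAssembly.isCoprime_discr_of_satisfiesHeegnerHypothesis hK hH
  have hτ2 : τ * τ = 1 := Walk.algEquiv_mul_self_eq_one hK τ hτ
  haveI : NeZero (p ^ k) := ⟨pow_ne_zero k hp.ne_zero⟩
  haveI : Finite (geomTorsion (W.baseChange K) ((p ^ k : ℕ) : ℤ)) :=
    finite_geomTorsion_of_neZero (W.baseChange K) (p ^ k)
  -- `c` is admissible at level `k`: every prime factor has index `≥ s + k ≥ k`
  have hsM' : ((k + s : ℕ) : ℕ∞) ≤ Zhang2014.levelIndex W p c := by rw [Nat.add_comm]; exact hsM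
  have hcidx : ∀ q ∈ c.primeFactors, k + s ≤ Zhang2014.kolyvaginIndex W p q :=
    Zhang2014.natCast_le_levelIndex_iff.mp hsM'
  have hc : Squarefree c ∧ ∀ q ∈ c.primeFactors,
      Zhang2014.IsKolyvaginPrime (W.conductorNorm ℤ) W K p q ∧ k ≤ Zhang2014.kolyvaginIndex W p q :=
    ⟨hcsq, fun q hq ↦ ⟨hcKol q hq, le_trans (Nat.le_add_right k s) (hcidx q hq)⟩⟩
  -- [GZ86 III (3.1)] at this frame (scoped schema), Gross Prop. 5.3 BY NAME, the sign function
  obtain ⟨n', hcop', hGZ'⟩ := HeegnerE0ImageFree.hGZ_of_Gross1991_imageFree hF1 W K hK hD3 hD4 hH p hp2 hirr Dt β ι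
  obtain ⟨ε, hε, h53⟩ := grossProp53_schema_kolyvagin W hK hH p Dt β ι
  obtain ⟨eb, heb, hebε⟩ := Walk.exists_signFunction ε hε
  -- the based data family with Prop. 4.7 along increasing prime chains (Gross Prop. 3.7 (2), corner-p1, irreducible + p split)
  obtain ⟨D, hDd, h47⟩ := Prop44.exists_data_h47Base_of_frobeniusCongruence_of_irr h37 W hK hD hH hp2 hp3 hHp hirr
    Dt β ι hk hc d
  -- the global intrinsic transverse family at level `p^k`
  obtain ⟨𝒯, h𝒯, -⟩ := Walk.exists_globalTransverseFamily W ι ((p ^ k : ℕ) : ℤ)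
  -- admissible numbers are divisor-closed
  have hadm : ∀ (s₀ : {m : ℕ // Squarefree m ∧ ∀ q ∈ m.primeFactors,
      Zhang2014.IsKolyvaginPrime (W.conductorNorm ℤ) W K p q ∧ k ≤ Zhang2014.kolyvaginIndex W p q})
      (m' : ℕ), m' ∣ s₀.1 → Squarefree m' ∧ ∀ q ∈ m'.primeFactors,
      Zhang2014.IsKolyvaginPrime (W.conductorNorm ℤ) W K p q ∧ k ≤ Zhang2014.kolyvaginIndex W p q :=
    fun s₀ m' hm' ↦ ⟨s₀.2.1.squarefree_of_dvd hm',
      fun q hq ↦ s₀.2.2 q (Nat.primeFactors_mono hm' s₀.2.1.ne_zero hq)⟩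
  -- depth bookkeeping at `c`: `m(c) = s < k`, `k + s ≤ M(c)`
  have hdiv : divOrd (D ⟨c, hc⟩) p = (s : ℕ∞) := by
    rw [hDd]; exact divOrd_eq_natCast_of_exact d p hdvd hndvd
  have hsMc : (s : ℕ∞) < Zhang2014.levelIndex W p c := by
    refine lt_of_lt_of_le ?_ hsM'
    exact_mod_cast Nat.lt_add_of_pos_left (Nat.lt_of_lt_of_le Nat.zero_lt_one hk)
  have hmc : (if divOrd (D ⟨c, hc⟩) p < Zhang2014.levelIndex W p c then divOrd (D ⟨c, hc⟩) p
      else (⊤ : ℕ∞)) = (s : ℕ∞) := by rw [hdiv, if_pos hsMc]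
  have h0 : (if divOrd (D ⟨c, hc⟩) p < Zhang2014.levelIndex W p c then divOrd (D ⟨c, hc⟩) p
      else (⊤ : ℕ∞)) < (k : ℕ∞) := by rw [hmc]; exact_mod_cast hsk
  have hMc : (k : ℕ∞) + (if divOrd (D ⟨c, hc⟩) p < Zhang2014.levelIndex W p c then divOrd (D ⟨c, hc⟩) p
      else ⊤) ≤ Zhang2014.levelIndex W p c := by rw [hmc]; exact_mod_cast hsM'
  -- τ-stability of the global family at the places of every admissible conductor (Gross §3 dihedral)
  have h𝒯σ' : ∀ (s₀ : {m : ℕ // Squarefree m ∧ ∀ q ∈ m.primeFactors,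
        Zhang2014.IsKolyvaginPrime (W.conductorNorm ℤ) W K p q ∧ k ≤ Zhang2014.kolyvaginIndex W p q})
      (v w : HeightOneSpectrum (𝓞 K)) (h : τ • v = w), v ∈ placesDividing K s₀.1 →
      ∀ x : galoisCohomology (((W.baseChange K).torsionGaloisModule ((p ^ k : ℕ) : ℤ)).toLocal
        (Sum.inr v : Place K)) 1,
      x ∈ 𝒯 (Sum.inr v) → conjActPlace W τ ((p ^ k : ℕ) : ℤ) h x ∈ 𝒯 (Sum.inr w) :=
    fun s₀ v w h hv x hx ↦ Walk.globalTransverse_conjActPlace_mem h𝒯 τ s₀.2.1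
      (forall_conjActPlace_mem_of_eq_iInf_transverseSubgroup W hK ι τ ((p ^ k : ℕ) : ℤ) s₀.1) v w h hv x hx
  -- ### the FULL kernel walk on the row objects
  have key := exists_coreVertex_of_orderedFamilies_of_classX9 W K hK hH p hX9 hHp
    Dt β ι τ hτ k hk 𝒯 D eb heb c hc h0 hMc ?hdisj ?hPT ?hκt
    (hordκ_of_admissibleData_of_irreducible W hK hND hD hp2 hirr hHp Dt β ι k D)
    (fun s₁ s₁' ℓ hℓ _ ↦ h47 s₁ s₁' ℓ hℓ)
  · -- ### read the conclusion in K5's currency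
    obtain ⟨s', hcs', hidx', hB, hcyc, hcard, hms'⟩ := key
    have hs0' : s'.1 ≠ 0 := s'.2.1.ne_zero
    -- `m(s') ≤ s`: finite depth `≤ s` below `M(s')`
    rw [hmc] at hms'
    have hlt' : divOrd (D s') p < Zhang2014.levelIndex W p s'.1 := by
      by_contra h
      rw [if_neg h, top_le_iff] at hms'
      exact ENat.coe_ne_top s hms'
    have hdle : divOrd (D s') p ≤ (s : ℕ∞) := by rwa [if_pos hlt'] at hms'
    have hnd' : ¬ PDiv (D s') p (s + 1) := fun h ↦ by
      have h1 : ((s + 1 : ℕ) : ℕ∞) ≤ (s : ℕ∞) := (le_divOrd_of_pDiv (p := p) (D s') h).trans hdle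
      exact absurd (by exact_mod_cast h1 : s + 1 ≤ s) (by omega)
    -- `P_{s'}` of infinite order: `E(K[s'])` has no `p`-torsion
    have hpc' : ¬ p ∣ s'.1 := fun h ↦ (s'.2.2 p (Nat.mem_primeFactors.mpr ⟨hp, h, hs0'⟩)).1.2.2.2.1 rfl
    have hbot := X11b.NoTorsionIrr.torsionBy_ringClassField_eq_bot_of_hasIrreducibleModPGaloisRep W hK ι hs0' hp
      hp2 hirr (WeierstrassCurve.exists_weilPairing_holds W p)
      (X11b.isUnramifiedIn_of_satisfiesHeegnerHypothesis_of_dvd hK hHp hp (dvd_refl p)) hpc'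
    have hA : ∀ R : (W.baseChange (ringClassField K ι s'.1)).toAffine.Point, (p : ℤ) • R = 0 → R = 0 := by
      intro R hR
      have hmem : R ∈ AddSubgroup.torsionBy (W.baseChange (ringClassField K ι s'.1)).toAffine.Point (p : ℤ) := by
        rw [mem_torsionBy_iff]
        exact hR
      rw [hbot] at hmem
      exact hmem
    have hnt' : ¬ IsOfFinAddOrder (D s').derivedPoint :=
      fun hfin ↦ hnd' (exists_pow_smul_eq_of_isOfFinAddOrder hp hA hfin (s + 1))
    -- `H_{𝓕(s')}` in the `modifiedSelmerGroup` currency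
    have hFeq : (selmerF W ((p ^ k : ℕ) : ℤ) 𝒯 (placesDividing K s'.1)).selmerGroup =
        modifiedSelmerGroup W K ι ((p ^ k : ℕ) : ℤ) s'.1 :=
      SelmerVocabulary.selmerGroup_selmerF_eq_modifiedSelmerGroup W ι ((p ^ k : ℕ) : ℤ) 𝒯 hs0'
        (fun x ↦ Walk.globalTransverse_mem_iff h𝒯 s'.2.1 x)
    rw [hFeq] at hB hcyc hcard
    -- the core-vertex package, with the two signs generalised (no dependent rewriting)
    have hpack : ∀ e₁ e₂ : ℤ, e₁ = (if eb s'.1 then (1 : ℤ) else -1) → e₂ = (if !eb s'.1 then (1 : ℤ) else -1) →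
        IsAddCyclic (signPart W K τ ((p ^ k : ℕ) : ℤ) e₁ (modifiedSelmerGroup W K ι ((p ^ k : ℕ) : ℤ) s'.1)) ∧
        Nat.card (signPart W K τ ((p ^ k : ℕ) : ℤ) e₁ (modifiedSelmerGroup W K ι ((p ^ k : ℕ) : ℤ) s'.1)) =
          p ^ k ∧
        signPart W K τ ((p ^ k : ℕ) : ℤ) e₂ (modifiedSelmerGroup W K ι ((p ^ k : ℕ) : ℤ) s'.1) = ⊥ := by
      rintro _ _ rfl rfl
      exact ⟨hcyc, hcard, hB⟩
    refine ⟨s'.1, D s', s'.2.1, fun q hq ↦ ⟨(s'.2.2 q hq).1, ?_⟩, ?_, hnt', hnd'⟩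
    · -- the level clause `c' ∈ Λ_{k+s}`
      rcases hidx' q hq with hqc | hq'
      · exact hcidx q hqc
      · rw [hmc] at hq'
        exact_mod_cast hq'
    · -- the core vertex, sign by sign
      dsimp only [IsGlobalCoreVertex]
      cases hb : eb s'.1
      · obtain ⟨h1, h2, h3⟩ := hpack (-1) 1 (by simp [hb]) (by simp [hb])
        exact Or.inr ⟨h3, h1, h2⟩
      · obtain ⟨h1, h2, h3⟩ := hpack 1 (-1) (by simp [hb]) (by simp [hb])
        exact Or.inl ⟨h1, h2, h3⟩
  case hdisj =>
    -- [J] §4.2 at one completion: `H¹_f ∩ H¹_tr = 0` at a Kolyvagin `λ`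
    intro ℓ hℓK hkℓ _ v hv
    exact Walk.globalTransverse_disjoint_kummer h𝒯
      (P := fun ℓ ↦ Zhang2014.IsKolyvaginPrime (W.conductorNorm ℤ) W K p ℓ)
      (fun ℓ hℓ w hw ↦ Walk.disjoint_kummer_iInf_transverseSubgroup W K hK hD ι k hℓ w hw)
      (fun ℓ hℓ ↦ hℓ.1) ℓ hℓK v hv
  case hPT =>
    -- Lemma 5.2 (iii), primal form, per sign — Poitou–Tate + self-duality of `𝓕(s)`
    intro s₀ ℓ hℓK hkℓ hℓs _ _ w hw b
    obtain ⟨inv, hperf, hvan, -, hSC, hconj⟩ := hPT K (p ^ k)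
    have h2 : 2 ≤ p ^ k := le_trans hp.two_le (Nat.le_self_pow (by omega) p)
    obtain ⟨e, hμ, hadd₁, hadd₂, hgal, halt, hnondeg, hτe⟩ := exists_weilDatum_liftAut W τ (p ^ k) h2
    have hs' : (if b then (1 : ℤ) else -1) = 1 ∨ (if b then (1 : ℤ) else -1) = -1 := by
      cases b <;> simp
    have hℓs' : ℓ ∉ s₀.1.primeFactors := fun h ↦ hℓs (Nat.dvd_of_mem_primeFactors h)
    exact Walk.natCard_map_localization_signPart_relaxedAt W τ p k e hμ hadd₁ hadd₂ hgal halt hnondeg hτe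
      hτ2 hp2 hk inv hperf hvan hSC (hconj τ) 𝒯 s₀.2.1.ne_zero (h𝒯σ' s₀)
      (Walk.globalTransverse_dualTransported_eq (ι := ι) h𝒯 s₀.2.1
        (fun 𝒯c h𝒯c ↦ RingClassTransverse.dualTransported_eq_of_localTransverseFamily W K hK hD ι p hp2 k hk
          s₀.1 s₀.2.1 (fun l hl ↦ (s₀.2.2 l hl).1) (fun l hl ↦ (s₀.2.2 l hl).2) 𝒯c h𝒯c e hμ hadd₁ hadd₂
          hgal halt hnondeg)
        inv hperf)
      hs' (fun ℓ' h1 h2' _ v' hv' hfix ↦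
        GlobalDuality.relIndex_kummer_ker_conjActPlace_eq_pow W K hK (hPT K) hp2 hτ hτ2 hk ℓ' h1 h2' v' hv'
          hfix _ hs')
      ℓ hℓK hkℓ hℓs' w hw
  case hκt =>
    -- §3.1 item 7: the class `κ̃_{s₀}` of a `p^u`-th root of `P_{s₀}`, `u = m(s₀)`
    intro s₀ hcs₀ hs₀
    by_cases hlt : divOrd (D s₀) p < Zhang2014.levelIndex W p s₀.1
    · rw [if_pos hlt] at hs₀ ⊢
      have hne : divOrd (D s₀) p ≠ ⊤ := ne_top_of_lt hlt
      obtain ⟨u, hu⟩ : ∃ u : ℕ, divOrd (D s₀) p = u := ⟨_, (ENat.coe_toNat hne).symm⟩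
      rw [hu] at hs₀ hlt ⊢
      simp only [ENat.toNat_coe]
      have hdvd₀ : PDiv (D s₀) p u := pDiv_of_le_divOrd _ _ _ (le_of_eq hu.symm)
      have hndvd₀ : ¬ PDiv (D s₀) p (u + 1) := fun h ↦ by
        have h' := le_divOrd_of_pDiv (p := p) (D s₀) h
        rw [hu] at h'
        exact absurd (by exact_mod_cast h' : u + 1 ≤ u) (by omega)
      have huk : ((u + k : ℕ) : ℕ∞) ≤ Zhang2014.levelIndex W p s₀.1 := by push_cast; exact hs₀
      have hkol : ∀ q ∈ s₀.1.primeFactors,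
          Zhang2014.IsKolyvaginPrime (W.conductorNorm ℤ) W K p q ∧ k + u ≤ Zhang2014.kolyvaginIndex W p q :=
        fun q hq ↦ ⟨(s₀.2.2 q hq).1, by
          rw [Nat.add_comm]; exact Zhang2014.natCast_le_levelIndex_iff.mp huk q hq⟩
      obtain ⟨hAk, Q, hQ, hQP, hord, hκ⟩ := exists_tildeClass_of_exactDepth_of_irreducible (Dt := Dt) (β := β)
        hK hND hD hp hp2 hirr hHp hk s₀.2.1 hkol (fun m' hm' ↦ D ⟨m', hadm s₀ m' hm'⟩) hdvd₀ hndvd₀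
      -- admissibility of `E(K[m']) ⊆ E(K̄)` mod `p^{k+u}` at the divisors of `s₀` (irreducibility + `p` split)
      have hAdata : ∀ (m' : ℕ) (hm' : m' ∣ s₀.1), IsAdmissible (absoluteGaloisGroup K)
          (D ⟨m', hadm s₀ m' hm'⟩).pointsSubgroup ((p ^ (k + u) : ℕ) : ℤ) := fun m' hm' ↦
        isAdmissible_of_irreducible_of_split hK hp hp2 hirr hHp s₀.2.1 hkol (fun m' hm' ↦ D ⟨m', hadm s₀ m' hm'⟩)
          m' hm'
      have hA : IsAdmissible (absoluteGaloisGroup K) (D s₀).pointsSubgroup ((p ^ (k + u) : ℕ) : ℤ) :=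
        hAdata s₀.1 dvd_rfl
      -- invariance of `[P_{s₀}]` mod `p^{k+u}` from the data at the divisors of `s₀`
      have hP : (D s₀).toGeomPoints (D s₀).derivedPoint ∈
          invPoints (absoluteGaloisGroup K) (D s₀).pointsSubgroup ((p ^ (k + u) : ℕ) : ℤ) :=
        KolyCert.toGeomPoints_derivedPoint_mem_invPoints_of_dvd_zhang hK ι Dt hp hND hD s₀.2.1 hkol
          (fun m' hm' ↦ D ⟨m', hadm s₀ m' hm'⟩) s₀.1 dvd_rfl
      -- PURE Selmer membership of the root class: Gross 6.2 (1) mod [GZ86 III (3.1)] at Kolyvagin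
      -- conductors (Kummer part, one level up) and Howard's transverseness (one level up)
      have hsel : (kolyvaginClass (W.baseChange K) ((p ^ k : ℕ) : ℤ)
            ((W.baseChange K).zsmul_geomPoints_surjective_of_charZero
              (by exact_mod_cast pow_ne_zero k hp.ne_zero)) hAk ((D s₀).toGeomPoints Q) hQ :
            galoisCohomology ((W.baseChange K).torsionGaloisModule ((p ^ k : ℕ) : ℤ)) 1) ∈
          (selmerF W ((p ^ k : ℕ) : ℤ) 𝒯 (placesDividing K s₀.1)).selmerGroup := by
        refine (SelmerVocabulary.mem_selmerGroup_selmerF_iff W _ 𝒯 s₀.2.1.ne_zero _).mpr ⟨?_, ?_⟩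
        · intro v hv
          refine JetchevIrreducibleCoreVertex.localization_rootClass_mem_kummer_of_admissible W hp (D s₀) k u hA Q
            hAk hQ hQP hP v ?_
          exact localization_kolyvaginClass_mem_kummerSelmerStructure_of_GZ31_of_irreducible_of_split_kolyvagin hCM1 hCM2
            hK hD3 hD4 hH hp2 hirr hHp Dt β ι hcop' hGZ' s₀.2.1 hkol (D s₀) v hv
        · exact JetchevIrreducibleCoreVertex.localization_rootClass_mem_globalTransverse_of_admissible W h𝒯 hK s₀.2.1
            hkol (D s₀) hA Q hAk hQ hQP hP (fun ℓ hℓ ↦ kolyvaginClass_mem_transverseKer W hK hD hp2 Dt β ι (k + u)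
              s₀.2.1 hkol (D s₀) hℓ)
      -- the sign: Gross Prop. 5.4 (1) for the root class, from Prop. 5.3 BY NAME (image-agnostic form, potss k9-c4)
      have hsign := JetchevIrreducibleCoreVertex.conjAct_kolyvaginClass_root_eq_sign_smul_zhang_of_admissible
        (Dt := Dt) (β := β) hK hp hND hD hk s₀.2.1 hkol (fun m' hm' ↦ D ⟨m', hadm s₀ m' hm'⟩) hAdata hτ ε
        (fun m' hm' τm hτm ↦ h53 m' (hadm s₀ m' hm').1 (fun q hq ↦ ((hadm s₀ m' hm').2 q hq).1)
          (D ⟨m', hadm s₀ m' hm'⟩) τm hτm) Q hQP hAk hQ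
      refine ⟨_, (mem_signPart_iff W K τ _ _ _ _).mpr ⟨hsel, by rw [hebε]; exact hsign⟩, hord, ?_⟩
      rw [← natCast_zsmul]
      exact hκ
    · -- degenerate case `M(s₀) = ∞`: then `s₀ = c = 1`, where the given datum has finite depth
      exfalso
      rw [if_neg hlt, top_add, top_le_iff] at hs₀
      have h1 : s₀.1 = 1 := by
        by_contra hne1
        have hlt1 : 1 < s₀.1 :=
          Nat.lt_of_le_of_ne (Nat.one_le_iff_ne_zero.mpr s₀.2.1.ne_zero) (Ne.symm hne1)
        obtain ⟨q, hq⟩ := Nat.nonempty_primeFactors.mpr hlt1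
        have hle : Zhang2014.levelIndex W p s₀.1 ≤ (Zhang2014.kolyvaginIndex W p q : ℕ∞) :=
          Finset.inf_le hq
        rw [hs₀, top_le_iff] at hle
        exact ENat.coe_ne_top _ hle
      have hc1 : c = 1 := Nat.dvd_one.mp (h1 ▸ hcs₀)
      have hs₀c : s₀ = ⟨c, hc⟩ := Subtype.ext (h1.trans hc1.symm)
      refine hlt ?_
      rw [hs₀, hs₀c, hdiv]
      exact ENat.coe_lt_top s

end Summit.BirchSwinnertonDyer.Rank1Residual.JET.Split

end
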